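import Literature.MathematicalPhysics.QuantumFieldTheory.IsingGaugeDeconfinementTransitionProofs
import Literature.MathematicalPhysics.QuantumFieldTheory.IsingGaugePlaquetteCorrelationLength
import Literature.Probability.LatticeModels.LebowitzPairTruncationIsing
import HarnessLib

/-!
# Duality of truncated plaquette correlations of `ℤ₂` lattice gauge theory on `ℤ³` with the
# energy–energy correlations of the Ising model, and the plaquette–plaquette mass gap in the
# DECONFINED phase (the `β > β_c` half of Duncan–Schweinhart 2026 Thm 8, `q = 2`, `d = 3`) — proved

P. Duncan, B. Schweinhart, *A topological formula for Potts lattice gauge theory correlations*,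
arXiv:2607.02434 (2026) [DuncanSchweinhart2026], Thm 8 ∕ Prop 24 (pp. 4, 19–20): for the `ℤ₂`
lattice gauge theory on `ℤ³`, `e^{-c₁N} ≤ Cov(W_{σ_0}, W_{σ_N}) ≤ e^{-c₀N}` for all `β ≠ β_c`
— the tree's NAMED FACT `DuncanSchweinhart2026_z2GaugeThree_plaquetteCovDecay`
(`IsingGaugePlaquetteCorrelationLength.lean`, stated for the free infinite-volume state of the
tree's Wilson-normalised `ℤ₂` theory, `z2PlaquettePairCov β x N`). The printed proof treats the two
sides of `β_c` separately: when the dual bonds are SUBcritical (large `β`; the printed «`β <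
β*(β_c(q))`» on p. 20 has the direction reversed relative to the paper's own decreasing involution
`β ↦ β*(β)`, transcriber's flag recorded with the fact) it is sharpness of the dual model
[DCRT19]; when they are supercritical (small `β`, `q = 2`) it is [Bod05] + [DCGR20].

This file PROVES the upper bound on the large-`β` (deconfined, dual-subcritical) side, with no
named fact, by the classical duality route (M. Aizenman, *Geometric analysis of Ising models III*,
Math. Phys. Anal. Geom. 28 (2025) [Aizenman2025], Thm 9.2 — the tree's
`Z2Duality.zdExpect_z2_prod_plaqSpin_eq_isingExpect_plus_disorderWeight`, F. Wegner, J. Math.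
Phys. 12 (1971) [Wegner1971] §III):

* §1–§2 **Duality of one- and two-plaquette functions in finite volume.** Under Thm 9.2 a
  plaquette variable `σ_p = A_{∂p}` of the free `ℤ₂` gauge box `ΛG_M = {-M,…,M+1}³` becomes the
  disorder insertion `e^{-2β* σ_uσ_v} = cosh 2β* - sinh 2β* · σ_uσ_v` on the dual bond `{u,v}` of
  the PLUS-boundary Ising box `box 3 M` at `β* = -½ log tanh β`; hence (exact identities)
  `⟨σ_p⟩^{free}_{ΛG_M,β} = cosh 2β* - sinh 2β* ⟨σ_uσ_v⟩⁺_{box M,β*}` and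
  `Cov^{free}_{ΛG_M,β}(σ_p, σ_{p'}) = sinh²(2β*) · Cov⁺_{box M,β*}(σ_uσ_v, σ_{u'}σ_{v'})`
  (`zdExpect_plaqSpin_eq`, `zdCov_plaqSpin_eq`).
* §3–§4 **Infinite volume.** The gauge boxes `ΛG_M` are sandwiched between the centred cubes, so
  by Griffiths' second inequality in the region (FLV 2022 Thm 4.1, tree theorems) the limits along
  `ΛG_M` are the cube limits; with the plus-state box limits of the Ising spin products
  (`hasBoxLimit_isingCorr_plus_holds`) this gives, for EVERY `β > 0` and `N ≥ 1`,
  `⟨W_{σ(x)}⟩_{ℤ³,β} = cosh 2β* - sinh 2β* · ⟨σ_{x-e₃}σ_x⟩⁺_{β*}` (`znWilsonLoopLimit_plaquette_eq`)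
  and the **duality of truncated correlations**
  `Cov_β(W_{σ(x)}, W_{σ(x)+Ne₃}) = sinh²(2β*) · ⟨σ_{x-e₃}σ_x ; σ_{x+(N-1)e₃}σ_{x+Ne₃}⟩⁺_{β*}`
  (`z2PlaquettePairCov_eq_sinh_sq_mul_plusCov`) — the plaquette–plaquette correlation length of
  `ℤ₂` LGT₃ IS the energy–energy correlation length of the dual Ising model (the `d = 3`
  counterpart of Duncan–Schweinhart's Thm 9 `ξ^f_β = ξ^w_{β*(β)}` on `ℤ⁴`).
* §5 **The deconfined phase.** For `β > z2GaugeCriticalBetaThree` the dual temperature is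
  subcritical (`Z2Duality.dualBeta_lt_criticalBeta`), the plus and free states agree
  (Lebowitz–Martin-Löf, `freeCorr_eq_plusCorr_of_spontaneousMagnetization_eq_zero`), the
  pair-truncation tree bound of Lebowitz 1974 ∕ Glimm–Jaffe Cor. 4.3.3
  (`freeCorr_two_mul_cov_le_sum_odd`, tree theorem) bounds the energy–energy covariance by four
  products of two two-point functions between the bonds, and sharpness of the Ising transition
  (Aizenman–Barsky–Fernández 1987 ∕ Duminil-Copin–Tassion 2016,
  `twoPoint_exponentialDecay_of_lt_criticalBeta_holds`) makes each decay like `e^{-κ(N-1)}`: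
  **`0 ≤ Cov_β(W_{σ(x)}, W_{σ(x)+Ne₃}) ≤ 8 sinh²(2β*) e^{2κ} · e^{-2κN}`** for all `x`, `N`
  (`z2PlaquettePairCov_le_exp_neg_of_gt_critical`) — the mirror image of the strong-coupling half
  `z2PlaquettePairCov_le_exp_neg_of_strongCoupling` (`ZnWilsonLoopStrongCouplingClustering.lean`).
* §6 In the shape of the fact: `Cov_β(W_{σ_0}, W_{σ_N}) ≤ e^{-c₀N}` for all `N ≥ 1`, `β > β_c`
  (`z2PlaquettePairCov_le_exp_neg_of_gt_critical'`, using `Cov ≤ 1 - tanh²β < 1`), and the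
  reduction `DuncanSchweinhart2026_z2GaugeThree_plaquetteCovDecay_of_lower_of_confinedUpper`: what
  remains of the fact is the LOWER bound `e^{-c₁N} ≤ Cov` (finite energy of the plaquette
  random-cluster representation, both phases) and the upper bound for `0 < β < β_c` (dual
  supercritical: [Bod05], [DCGR20]).

HONEST FRAMING: `ℤ₂`, `d = 3`, an abelian calibration result (cell `ym-ir`, census row A5); the
mechanism (Kramers–Wannier–Wegner duality + Ising sharpness) has width `0` toward `SU(N)` and
nothing here bears on four-dimensional Yang–Mills, on `BalabanLadder.IR`, or on the mass gap
(Clay). In the `ym` ladder only the conditional finite-`𝕋⁴` rung `BalabanLadder.UV` is closed by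
any route.

## References

* P. Duncan, B. Schweinhart, arXiv:2607.02434 (2026), Thm 8 (p. 4), Prop. 24 and its proof
  (pp. 19–20), Thm 9 (p. 5). [DuncanSchweinhart2026]
* M. Aizenman, Math. Phys. Anal. Geom. 28 (2025), arXiv:2509.02850, §9.2 Thm 9.2 (2). [Aizenman2025]
* F. J. Wegner, J. Math. Phys. 12 (1971) 2259–2272, §III. [Wegner1971]
* J. Glimm, A. Jaffe, *Quantum Physics*, 2nd ed. (1987), Cor. 4.3.3; J. L. Lebowitz, Comm. Math.
  Phys. 35 (1974) 87–92. [GlimmJaffe1987] [Lebowitz1974]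
* M. Aizenman, D. J. Barsky, R. Fernández, J. Stat. Phys. 47 (1987), Thm. 1; H. Duminil-Copin,
  V. Tassion, CMP 343 (2016) Thm 1.2. [AizenmanBarskyFernandezJSP1987] [DuminilCopinTassionCMP2016]
* J. L. Lebowitz, A. Martin-Löf, CMP 25 (1972) 276–282. [LebowitzMartinlof1972]
-/

noncomputable section

open MeasureTheory Finset Filter Topology
open scoped symmDiff
open Literature.Probability.LatticeModels
open Literature.Barriers.QuantumFields (rootsOfUnityCircle znRep)

namespace Literature.MathematicalPhysics.QuantumFieldTheory

open AreaLaw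

namespace Z2Duality

/-! ### §1 The unit plaquette `σ(w) = (w; 0, 1)`, its dual bond `{w - e₃, w}`, linear algebra of
the disorder insertion -/

section Geometry

/-
Notation of the docstrings: `σ(w) = (w; 0, 1) : Plaq 3` is the unit plaquette with lower corner `w`
in the `(x₁,x₂)`-plane (Duncan–Schweinhart's `σ_N = [0,1]² × {N}` is `σ(N e₃)`); its dual bond
joins the cubes `w - e₃` and `w`, and `verts {σ(w)} = {w - e₃, w}` (the tree's `Z2Duality.verts`,
the endpoints of the dual bonds of a set of faces) carries the dual energy observable
`ε(w) = σ_{w-e₃}σ_w`. No new definitions are introduced.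
-/

/-- The sheet of the `1 × 1` loop at `w` is the single plaquette `σ(w) = (w; 0, 1)`. [folklore] -/
private theorem rectPlaqs_one_one (w : Probability.LatticeModels.Site 3) :
    rectPlaqs w 0 1 1 1 = {((w, 0, 1) : Plaq 3)} := by
  unfold rectPlaqs
  rw [Finset.range_one, Finset.singleton_product_singleton, Finset.image_singleton]
  simp

/-- The `1 × 1` Wilson loop of the `ℤ₂` theory is the plaquette variable: `W_{∂σ(w)} = A_{∂σ(w)}`.
[cite: Aizenman2025, §9.1 (A_γ = ∏_{b ∈ γ} A_b)] -/
theorem zdWilsonLoop_one_one (w : Probability.LatticeModels.Site 3)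
    (U : ZdGaugeConfig 3 ↥(rootsOfUnityCircle 2)) :
    zdWilsonLoop (znRep 2) w 0 1 1 1 U = plaqSpin U (w, 0, 1) := by
  rw [zdWilsonLoop_znRep_two_eq_prod_plaqSpin w (show (0 : Fin 3) ≠ 1 by decide), rectPlaqs_one_one,
    Finset.prod_singleton]

/-- The `1 × 1` Wilson loop observable as a function. [cite: Aizenman2025, §9.1] -/
theorem zdWilsonLoop_one_one_eq (w : Probability.LatticeModels.Site 3) :
    zdWilsonLoop (znRep 2) w 0 1 1 1 = fun U => plaqSpin U (w, 0, 1) :=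
  funext (zdWilsonLoop_one_one w)

/-- The lower cube of `σ(w)` is `w - e₃`. [cite: Aizenman2025, §9.2] -/
theorem lowCube_unitPlaq (w : Probability.LatticeModels.Site 3) :
    lowCube ((w, 0, 1) : Plaq 3) = w - Pi.single 2 1 := by
  have h : third 0 1 = (2 : Fin 3) := by decide
  show w - Pi.single (third 0 1) 1 = _
  rw [h]

/-- The endpoints of the dual bond of `σ(w)`: `verts {σ(w)} = {w - e₃, w}`.
[cite: Aizenman2025, §9.2 («plaquettes' dual objects in three dimensions are edges»)] -/
theorem verts_unitPlaq (w : Probability.LatticeModels.Site 3) :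
    verts {((w, 0, 1) : Plaq 3)} = {w - Pi.single 2 1, w} := by
  rw [verts, Finset.singleton_biUnion, lowCube_unitPlaq]

/-- The dual bond of `σ(w)` is `{w - e₃, w}`. [cite: Aizenman2025, §9.2] -/
theorem dualEdge_unitPlaq (w : Probability.LatticeModels.Site 3) :
    dualEdge ((w, 0, 1) : Plaq 3) = s(w - Pi.single 2 1, w) := by
  rw [dualEdge, lowCube_unitPlaq]

/-- `w - e₃ ≠ w`. [folklore] -/
private theorem sub_single_ne_self (w : Probability.LatticeModels.Site 3) : w - Pi.single 2 1 ≠ w := by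
  intro h
  have := congrFun h 2
  simp at this

/-- `(w + c e₃) - e₃ = w + (c-1) e₃`. [folklore] -/
private theorem add_single_sub_single (w : Probability.LatticeModels.Site 3) (c : ℤ) :
    w + Pi.single 2 c - Pi.single 2 1 = w + Pi.single 2 (c - 1) := by
  ext t
  simp only [Pi.add_apply, Pi.sub_apply, Pi.single_apply]
  split_ifs <;> ring

/-- The dual bond of `σ(x + c e₃)` has endpoints `{x + (c-1)e₃, x + c e₃}`. [folklore] -/
private theorem verts_unitPlaq_add_single (x : Probability.LatticeModels.Site 3) (c : ℤ) :
    verts {((x + Pi.single 2 c, 0, 1) : Plaq 3)} = {x + Pi.single 2 (c - 1), x + Pi.single 2 c} := by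
  rw [verts_unitPlaq, add_single_sub_single]

/-- `verts {σ(x)} = {x + (-1)e₃, x + 0·e₃}`. [folklore] -/
private theorem verts_unitPlaq_eq (x : Probability.LatticeModels.Site 3) :
    verts {((x, 0, 1) : Plaq 3)} = {x + Pi.single 2 (0 - 1), x + Pi.single 2 0} := by
  rw [← verts_unitPlaq_add_single, Pi.single_zero, add_zero]

/-- Distinct heights give distinct points on the `e₃`-axis through `x`. [folklore] -/
private theorem add_single_injective (x : Probability.LatticeModels.Site 3) :
    Function.Injective fun k : ℤ => x + Pi.single (2 : Fin 3) k := by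
  intro k k' h
  have := congrFun h 2
  simpa using this

/-- The dual energy observable: the bond spin of the dual bond of `σ(w)` is the spin product over
`verts {σ(w)} = {w - e₃, w}`. [cite: Aizenman2025, §9.2] -/
theorem bondSpin_dualEdge_unitPlaq (w : Probability.LatticeModels.Site 3)
    (σ : SpinConfig (Probability.LatticeModels.Site 3)) :
    bondSpin σ (dualEdge ((w, 0, 1) : Plaq 3)) = spinProduct (verts {((w, 0, 1) : Plaq 3)}) σ := by
  rw [dualEdge_unitPlaq, bondSpin_mk_eq_spinProduct (sub_single_ne_self w), verts_unitPlaq]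

/-- `verts {σ(w)}` has two elements. [folklore] -/
private theorem card_verts_unitPlaq (w : Probability.LatticeModels.Site 3) :
    (verts {((w, 0, 1) : Plaq 3)}).card = 2 := by
  rw [verts_unitPlaq, Finset.card_pair (sub_single_ne_self w)]

/-- `σ(w)` is a face of the gauge box `ΛG_M` as soon as `w ∈ box 3 M`. [cite: Aizenman2025, §9.2] -/
theorem unitPlaq_mem_faces {M : ℕ} {w : Probability.LatticeModels.Site 3} (hw : w ∈ box 3 M) :
    ((w, 0, 1) : Plaq 3) ∈ plaquettesIn (gaugeBox M) :=
  lowFace_mem_faces hw (by decide)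

/-- Distinct corners give distinct plaquettes. [folklore] -/
private theorem unitPlaq_ne {w w' : Probability.LatticeModels.Site 3} (h : w ≠ w') :
    ((w, 0, 1) : Plaq 3) ≠ (w', 0, 1) := fun e => h (Prod.mk.inj e).1

/-- Distinct corners give distinct dual bonds. [folklore] -/
private theorem dualEdge_unitPlaq_ne {w w' : Probability.LatticeModels.Site 3} (h : w ≠ w') :
    dualEdge ((w, 0, 1) : Plaq 3) ≠ dualEdge ((w', 0, 1) : Plaq 3) := by
  rw [dualEdge_unitPlaq, dualEdge_unitPlaq]
  intro he
  rcases Sym2.eq_iff.1 he with ⟨-, h2⟩ | ⟨h1, h2⟩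
  · exact h h2
  · -- `w - e₃ = w'` and `w = w' - e₃`: impossible
    have a := congrFun h1 2
    have b := congrFun h2 2
    simp at a b
    omega

/-- `e^{-2βs} = cosh 2β - sinh 2β · s` for `s = ±1`. [folklore] -/
private theorem exp_neg_two_mul_eq_cosh_sub {s : ℝ} (hs : s = 1 ∨ s = -1) (β : ℝ) :
    Real.exp (-2 * β * s) = Real.cosh (2 * β) - Real.sinh (2 * β) * s := by
  rcases hs with rfl | rfl
  · rw [mul_one, show -2 * β = -(2 * β) by ring, ← Real.cosh_sub_sinh]; ring
  · rw [show -2 * β * -1 = 2 * β by ring, ← Real.cosh_add_sinh]; ring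

/-- The disorder insertion on ONE dual bond is affine in the bond spin:
`μ_{{e}}(σ) = cosh 2β - sinh 2β · σ_{verts}`. [cite: Aizenman2025, §9.3 (T_S as a spin observable)] -/
theorem disorderWeight_single_unitPlaq (β : ℝ) (w : Probability.LatticeModels.Site 3) :
    disorderWeight β (({((w, 0, 1) : Plaq 3)} : Finset (Plaq 3)).image dualEdge) = fun σ =>
      Real.cosh (2 * β) + (-Real.sinh (2 * β)) * spinProduct (verts {((w, 0, 1) : Plaq 3)}) σ := by
  funext σ
  rw [Finset.image_singleton, disorderWeight, Finset.prod_singleton,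
    exp_neg_two_mul_eq_cosh_sub (bondSpin_eq_one_or σ _) β, bondSpin_dualEdge_unitPlaq]
  ring

/-- The disorder insertion on TWO dual bonds is the product of two affine factors.
[cite: Aizenman2025, §9.3 (T_S as a spin observable)] -/
theorem disorderWeight_pair_unitPlaq (β : ℝ) {w w' : Probability.LatticeModels.Site 3} (h : w ≠ w') :
    disorderWeight β (({((w, 0, 1) : Plaq 3), ((w', 0, 1) : Plaq 3)} : Finset (Plaq 3)).image dualEdge) =
      fun σ =>
      (Real.cosh (2 * β) + (-Real.sinh (2 * β)) * spinProduct (verts {((w, 0, 1) : Plaq 3)}) σ) *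
        (Real.cosh (2 * β) + (-Real.sinh (2 * β)) * spinProduct (verts {((w', 0, 1) : Plaq 3)}) σ) := by
  funext σ
  rw [Finset.image_insert, Finset.image_singleton, disorderWeight,
    Finset.prod_pair (dualEdge_unitPlaq_ne h),
    exp_neg_two_mul_eq_cosh_sub (bondSpin_eq_one_or σ _) β,
    exp_neg_two_mul_eq_cosh_sub (bondSpin_eq_one_or σ _) β,
    bondSpin_dualEdge_unitPlaq, bondSpin_dualEdge_unitPlaq]
  ring

end Geometry

/-! ### §2 Expectations of affine spin observables; the one- and two-plaquette duality in finite
volume -/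

section FiniteVolume

variable {V : Type*} [DecidableEq V] (G : SimpleGraph V) [G.LocallyFinite]

/-- `⟨a + b σ_A⟩ = a + b ⟨σ_A⟩` (the finite-volume Gibbs measure is a probability measure). [folklore] -/
private theorem isingExpect_const_add_mul_spinProduct (Λ : Finset V) (β h : ℝ) (bc : BoundaryCondition V)
    (a b : ℝ) (A : Finset V) :
    isingExpect G Λ β h bc (fun σ => a + b * spinProduct A σ) = a + b * isingCorr G Λ β h bc A := by
  unfold isingCorr isingExpect
  rw [integral_add (integrable_const a) ((integrable_spinProduct _ A).const_mul b),
    integral_const, probReal_univ, one_smul, integral_const_mul]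

/-- `⟨(a + bσ_A)(a + bσ_B)⟩ = a² + ab(⟨σ_A⟩ + ⟨σ_B⟩) + b²⟨σ_{A∆B}⟩` (`σ_Aσ_B = σ_{A∆B}`). [folklore] -/
private theorem isingExpect_affine_mul_affine (Λ : Finset V) (β h : ℝ) (bc : BoundaryCondition V)
    (a b : ℝ) (A B : Finset V) :
    isingExpect G Λ β h bc (fun σ => (a + b * spinProduct A σ) * (a + b * spinProduct B σ)) =
      a ^ 2 + a * b * (isingCorr G Λ β h bc A + isingCorr G Λ β h bc B) +
        b ^ 2 * isingCorr G Λ β h bc (A ∆ B) := by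
  have hf : (fun σ => (a + b * spinProduct A σ) * (a + b * spinProduct B σ)) = fun σ =>
      (a ^ 2 + a * b * spinProduct A σ) + (a * b * spinProduct B σ + b ^ 2 * spinProduct (A ∆ B) σ) := by
    funext σ
    rw [← spinProduct_mul_spinProduct]
    ring
  rw [hf]
  unfold isingCorr isingExpect
  have i1 : Integrable (fun σ => a ^ 2 + a * b * spinProduct A σ) (isingMeasure G Λ β h bc) :=
    (integrable_const _).add ((integrable_spinProduct _ A).const_mul _)
  have i2 : Integrable (fun σ => a * b * spinProduct B σ + b ^ 2 * spinProduct (A ∆ B) σ)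
      (isingMeasure G Λ β h bc) :=
    ((integrable_spinProduct _ B).const_mul _).add ((integrable_spinProduct _ (A ∆ B)).const_mul _)
  rw [integral_add i1 i2, integral_add (integrable_const _) ((integrable_spinProduct _ A).const_mul _),
    integral_add ((integrable_spinProduct _ B).const_mul _) ((integrable_spinProduct _ (A ∆ B)).const_mul _),
    integral_const, probReal_univ, one_smul, integral_const_mul, integral_const_mul, integral_const_mul]
  ring

/-- **Covariance of two affine spin observables**:
`⟨(a+bσ_A)(a+bσ_B)⟩ - ⟨a+bσ_A⟩⟨a+bσ_B⟩ = b² (⟨σ_{A∆B}⟩ - ⟨σ_A⟩⟨σ_B⟩)`. [folklore] -/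
private theorem isingCov_affine (Λ : Finset V) (β h : ℝ) (bc : BoundaryCondition V) (a b : ℝ) (A B : Finset V) :
    isingExpect G Λ β h bc (fun σ => (a + b * spinProduct A σ) * (a + b * spinProduct B σ)) -
        isingExpect G Λ β h bc (fun σ => a + b * spinProduct A σ) *
          isingExpect G Λ β h bc (fun σ => a + b * spinProduct B σ) =
      b ^ 2 * (isingCorr G Λ β h bc (A ∆ B) - isingCorr G Λ β h bc A * isingCorr G Λ β h bc B) := by
  rw [isingExpect_affine_mul_affine, isingExpect_const_add_mul_spinProduct,
    isingExpect_const_add_mul_spinProduct]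
  ring

variable {M : ℕ}

/-- **Duality of the one-plaquette function** (Thm 9.2 with `S = {σ(w)}`): for `β > 0` and
`w ∈ box 3 M`, `⟨A_{∂σ(w)}⟩^{free}_{ΛG_M,β} = cosh 2β* - sinh 2β* · ⟨σ_{w-e₃}σ_w⟩⁺_{box M,β*}`.
[cite: Aizenman2025, §9.2 Thm 9.2 (2)] -/
theorem zdExpect_plaqSpin_eq {β : ℝ} (hβ : 0 < β) {w : Probability.LatticeModels.Site 3}
    (hw : w ∈ box 3 M) :
    zdExpect (znRep 2) β (gaugeBox M) (fun U => plaqSpin U (w, 0, 1)) =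
      Real.cosh (2 * dualBeta β) - Real.sinh (2 * dualBeta β) *
        isingCorr (zdGraph 3) (box 3 M) (dualBeta β) 0 .plus (verts {((w, 0, 1) : Plaq 3)}) := by
  have h := zdExpect_z2_prod_plaqSpin_eq_isingExpect_plus_disorderWeight hβ (M := M) (S := {((w, 0, 1) : Plaq 3)})
    (Finset.singleton_subset_iff.2 (unitPlaq_mem_faces hw))
  simp only [Finset.prod_singleton] at h
  rw [h, disorderWeight_single_unitPlaq, isingExpect_const_add_mul_spinProduct]
  ring

/-- **Duality of the two-plaquette function** (Thm 9.2 with `S = {σ(w), σ(w')}`, `w ≠ w'`).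
[cite: Aizenman2025, §9.2 Thm 9.2 (2)] -/
theorem zdExpect_plaqSpin_mul_plaqSpin_eq {β : ℝ} (hβ : 0 < β) {w w' : Probability.LatticeModels.Site 3}
    (hw : w ∈ box 3 M) (hw' : w' ∈ box 3 M) (hne : w ≠ w') :
    zdExpect (znRep 2) β (gaugeBox M) (fun U => plaqSpin U (w, 0, 1) * plaqSpin U (w', 0, 1)) =
      isingExpect (zdGraph 3) (box 3 M) (dualBeta β) 0 .plus (fun σ =>
        (Real.cosh (2 * dualBeta β) + (-Real.sinh (2 * dualBeta β)) * spinProduct (verts {((w, 0, 1) : Plaq 3)}) σ) *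
          (Real.cosh (2 * dualBeta β) + (-Real.sinh (2 * dualBeta β)) * spinProduct (verts {((w', 0, 1) : Plaq 3)}) σ)) := by
  have hS : ({((w, 0, 1) : Plaq 3), ((w', 0, 1) : Plaq 3)} : Finset (Plaq 3)) ⊆ plaquettesIn (gaugeBox M) :=
    Finset.insert_subset_iff.2 ⟨unitPlaq_mem_faces hw, Finset.singleton_subset_iff.2 (unitPlaq_mem_faces hw')⟩
  have h := zdExpect_z2_prod_plaqSpin_eq_isingExpect_plus_disorderWeight hβ (M := M) hS
  rw [show (fun U : ZdGaugeConfig 3 ↥(rootsOfUnityCircle 2) => ∏ p ∈ ({((w, 0, 1) : Plaq 3), ((w', 0, 1) : Plaq 3)} : Finset (Plaq 3)),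
      plaqSpin U p) = fun U => plaqSpin U (w, 0, 1) * plaqSpin U (w', 0, 1) from
    funext fun U => Finset.prod_pair (unitPlaq_ne hne)] at h
  rw [h, disorderWeight_pair_unitPlaq _ hne]

/-- **Duality of truncated plaquette correlations, finite volume**: for `β > 0`, `w ≠ w'` in
`box 3 M`,
`⟨σ_pσ_{p'}⟩ - ⟨σ_p⟩⟨σ_{p'}⟩ (free gauge box ΛG_M, β) = sinh²(2β*) (⟨ε ε'⟩⁺ - ⟨ε⟩⁺⟨ε'⟩⁺) (box M, β*)`
with `ε = σ_{w-e₃}σ_w`, `ε' = σ_{w'-e₃}σ_{w'}` the dual bond energies.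
[cite: Aizenman2025, §9.2 Thm 9.2 (2); Wegner1971 §III] -/
theorem zdCov_plaqSpin_eq {β : ℝ} (hβ : 0 < β) {w w' : Probability.LatticeModels.Site 3}
    (hw : w ∈ box 3 M) (hw' : w' ∈ box 3 M) (hne : w ≠ w') :
    zdExpect (znRep 2) β (gaugeBox M) (fun U => plaqSpin U (w, 0, 1) * plaqSpin U (w', 0, 1)) -
        zdExpect (znRep 2) β (gaugeBox M) (fun U => plaqSpin U (w, 0, 1)) *
          zdExpect (znRep 2) β (gaugeBox M) (fun U => plaqSpin U (w', 0, 1)) =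
      Real.sinh (2 * dualBeta β) ^ 2 *
        (isingCorr (zdGraph 3) (box 3 M) (dualBeta β) 0 .plus (verts {((w, 0, 1) : Plaq 3)} ∆ verts {((w', 0, 1) : Plaq 3)}) -
          isingCorr (zdGraph 3) (box 3 M) (dualBeta β) 0 .plus (verts {((w, 0, 1) : Plaq 3)}) *
            isingCorr (zdGraph 3) (box 3 M) (dualBeta β) 0 .plus (verts {((w', 0, 1) : Plaq 3)})) := by
  have h1 := zdExpect_z2_prod_plaqSpin_eq_isingExpect_plus_disorderWeight hβ (M := M) (S := {((w, 0, 1) : Plaq 3)})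
    (Finset.singleton_subset_iff.2 (unitPlaq_mem_faces hw))
  have h2 := zdExpect_z2_prod_plaqSpin_eq_isingExpect_plus_disorderWeight hβ (M := M) (S := {((w', 0, 1) : Plaq 3)})
    (Finset.singleton_subset_iff.2 (unitPlaq_mem_faces hw'))
  simp only [Finset.prod_singleton] at h1 h2
  rw [zdExpect_plaqSpin_mul_plaqSpin_eq hβ hw hw' hne, h1, h2, disorderWeight_single_unitPlaq,
    disorderWeight_single_unitPlaq, isingCov_affine]
  ring

end FiniteVolume

/-! ### §3 Limits along the gauge boxes `ΛG_M` are the cube limits -/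

section GaugeBoxLimit

/-- `box 3 M ⊆ ΛG_M = {-M,…,M+1}³`. [cite: Aizenman2025, §9.2 (Thm 9.2 (1): rectangular subgraphs Λ ⊂ ℤ³ and their duals Λ*)] -/
theorem box_subset_gaugeBox (M : ℕ) : box 3 M ⊆ gaugeBox M := by
  intro x hx
  rw [mem_gaugeBox]
  intro t
  have := (mem_box.1 hx t)
  omega

/-- `ΛG_M = {-M,…,M+1}³ ⊆ box 3 (M+1)`. [cite: Aizenman2025, §9.2 (Thm 9.2 (1): rectangular subgraphs Λ ⊂ ℤ³ and their duals Λ*)] -/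
theorem gaugeBox_subset_box_succ (M : ℕ) : gaugeBox M ⊆ box 3 (M + 1) := by
  intro x hx
  rw [mem_box]
  intro t
  have := (mem_gaugeBox.1 hx t)
  push_cast
  omega

/-- **A region-monotone quantity has the same limit along the gauge boxes as along the cubes**
(sandwich `box M ⊆ ΛG_M ⊆ box (M+1)`). [cite: ForsstromLenellsViklund2022, Thm 4.1 (ii) proof (comparison of nested boxes, p. 15)] -/
theorem tendsto_gaugeBox_of_mono {f : Finset (Probability.LatticeModels.Site 3) → ℝ}
    (hmono : ∀ ⦃Λ Λ' : Finset (Probability.LatticeModels.Site 3)⦄, Λ ⊆ Λ' → f Λ ≤ f Λ') {w : ℝ}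
    (hw : HasBoxLimit f w) :
    Tendsto (fun M : ℕ => f (gaugeBox M)) atTop (𝓝 w) := by
  have hlo : Tendsto (fun M : ℕ => f (box 3 M)) atTop (𝓝 w) := hw
  have hhi : Tendsto (fun M : ℕ => f (box 3 (M + 1))) atTop (𝓝 w) := hw.comp (tendsto_add_atTop_nat 1)
  exact tendsto_of_tendsto_of_tendsto_of_le_of_le hlo hhi
    (fun M => hmono (box_subset_gaugeBox M)) (fun M => hmono (gaugeBox_subset_box_succ M))

end GaugeBoxLimit

/-! ### §4 Infinite volume: the one-plaquette dictionary and the duality of truncated correlations -/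

section InfiniteVolume

/-- **The infinite-volume plaquette expectation of `ℤ₂` LGT₃ is the dual energy density**:
`⟨W_{∂σ(x)}⟩_{ℤ³,β} = cosh 2β* - sinh 2β* · ⟨σ_{x-e₃}σ_x⟩⁺_{β*}` for every `β > 0`
(`e^{-2β*} = tanh β`; both sides are the limits of the two sides of `zdExpect_plaqSpin_eq`).
[cite: Aizenman2025, §9.2 Thm 9.2 (2); Wegner1971 §III] -/
theorem znWilsonLoopLimit_plaquette_eq {β : ℝ} (hβ : 0 < β) (x : Probability.LatticeModels.Site 3) :
    znWilsonLoopLimit 2 β x 0 1 1 1 =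
      Real.cosh (2 * dualBeta β) - Real.sinh (2 * dualBeta β) * plusCorr 3 (dualBeta β) 0 (verts {((x, 0, 1) : Plaq 3)}) := by
  have h01 : (0 : Fin 3) ≠ 1 := by decide
  have hβs : 0 ≤ dualBeta β := (dualBeta_pos hβ).le
  -- gauge side along the gauge boxes
  have hG : Tendsto (fun M : ℕ => zdExpect (znRep 2) β (gaugeBox M) (zdWilsonLoop (znRep 2) x 0 1 1 1))
      atTop (𝓝 (znWilsonLoopLimit 2 β x 0 1 1 1)) :=
    tendsto_gaugeBox_of_mono (fun _ _ hΛ => zdExpect_zn_wilsonLoop_mono_region hβ.le hΛ x h01 1 1)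
      (hasBoxLimit_znWilsonLoopLimit hβ.le x h01 1 1)
  -- Ising side along the cubes
  have hI : Tendsto (fun M : ℕ => Real.cosh (2 * dualBeta β) - Real.sinh (2 * dualBeta β) *
      isingCorr (zdGraph 3) (box 3 M) (dualBeta β) 0 .plus (verts {((x, 0, 1) : Plaq 3)})) atTop
      (𝓝 (Real.cosh (2 * dualBeta β) - Real.sinh (2 * dualBeta β) * plusCorr 3 (dualBeta β) 0 (verts {((x, 0, 1) : Plaq 3)}))) :=
    tendsto_const_nhds.sub ((hasBoxLimit_isingCorr_plus_holds hβs le_rfl (verts {((x, 0, 1) : Plaq 3)})).const_mul _)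
  -- the two sequences agree eventually
  obtain ⟨M₀, hM₀⟩ := exists_forall_subset_box 3 ({x} : Finset (Probability.LatticeModels.Site 3))
  refine tendsto_nhds_unique (hG.congr' ?_) hI
  filter_upwards [eventually_ge_atTop M₀] with M hM
  have hx : x ∈ box 3 M := hM₀ M hM (Finset.mem_singleton_self x)
  rw [zdWilsonLoop_one_one_eq, zdExpect_plaqSpin_eq hβ hx]

/-- **Duality of truncated correlations (`ℤ₂` LGT₃ ↔ Ising₃), infinite volume**: for every `β > 0`,
every `x` and every `N ≥ 1`,
`Cov_β(W_{σ(x)}, W_{σ(x)+Ne₃}) = sinh²(2β*) · (⟨εε'⟩⁺_{β*} - ⟨ε⟩⁺_{β*}⟨ε'⟩⁺_{β*})`,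
`ε = σ_{x-e₃}σ_x`, `ε' = σ_{x+(N-1)e₃}σ_{x+Ne₃}`, `e^{-2β*} = tanh β`: the plaquette–plaquette truncated
correlation of the free infinite-volume `ℤ₂` gauge theory IS `sinh²(2β*)` times the energy–energy
truncated correlation of the plus-state Ising model at the dual temperature — the `d = 3` form of
Duncan–Schweinhart's «`ξ^f_β = ξ^w_{β*(β)}`» (Thm 9, stated there on `ℤ⁴`).
[cite: Aizenman2025, §9.2 Thm 9.2 (2); DuncanSchweinhart2026 Thm 9 (p. 5) and Prop. 24 (p. 19)] -/
theorem z2PlaquettePairCov_eq_sinh_sq_mul_plusCov {β : ℝ} (hβ : 0 < β)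
    (x : Probability.LatticeModels.Site 3) {N : ℕ} (hN : 1 ≤ N) :
    z2PlaquettePairCov β x N =
      Real.sinh (2 * dualBeta β) ^ 2 *
        (plusCorr 3 (dualBeta β) 0 (verts {((x, 0, 1) : Plaq 3)} ∆ verts {((x + Pi.single 2 (N : ℤ), 0, 1) : Plaq 3)}) -
          plusCorr 3 (dualBeta β) 0 (verts {((x, 0, 1) : Plaq 3)}) *
            plusCorr 3 (dualBeta β) 0 (verts {((x + Pi.single 2 (N : ℤ), 0, 1) : Plaq 3)})) := by
  have h01 : (0 : Fin 3) ≠ 1 := by decide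
  have hβs : 0 ≤ dualBeta β := (dualBeta_pos hβ).le
  set x' : Probability.LatticeModels.Site 3 := x + Pi.single 2 (N : ℤ) with hx'
  have hne : x ≠ x' := by
    intro h
    have := congrFun h 2
    simp [hx'] at this
    omega
  -- gauge side: the three pieces along the gauge boxes
  have hP : Tendsto (fun M : ℕ => zdExpect (znRep 2) β (gaugeBox M) (fun U =>
      zdWilsonLoop (znRep 2) x 0 1 1 1 U * zdWilsonLoop (znRep 2) x' 0 1 1 1 U)) atTop
      (𝓝 (znWilsonPairLimit 2 β x 0 1 1 1 x' 0 1 1 1)) :=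
    tendsto_gaugeBox_of_mono
      (fun _ _ hΛ => zdExpect_zn_wilsonLoop_mul_mono_region hβ.le hΛ x x' h01 h01 1 1 1 1)
      (hasBoxLimit_znWilsonPairLimit hβ.le x x' h01 h01 1 1 1 1)
  have hA : Tendsto (fun M : ℕ => zdExpect (znRep 2) β (gaugeBox M) (zdWilsonLoop (znRep 2) x 0 1 1 1))
      atTop (𝓝 (znWilsonLoopLimit 2 β x 0 1 1 1)) :=
    tendsto_gaugeBox_of_mono (fun _ _ hΛ => zdExpect_zn_wilsonLoop_mono_region hβ.le hΛ x h01 1 1)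
      (hasBoxLimit_znWilsonLoopLimit hβ.le x h01 1 1)
  have hB : Tendsto (fun M : ℕ => zdExpect (znRep 2) β (gaugeBox M) (zdWilsonLoop (znRep 2) x' 0 1 1 1))
      atTop (𝓝 (znWilsonLoopLimit 2 β x' 0 1 1 1)) :=
    tendsto_gaugeBox_of_mono (fun _ _ hΛ => zdExpect_zn_wilsonLoop_mono_region hβ.le hΛ x' h01 1 1)
      (hasBoxLimit_znWilsonLoopLimit hβ.le x' h01 1 1)
  have hG : Tendsto (fun M : ℕ => zdExpect (znRep 2) β (gaugeBox M) (fun U =>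
      zdWilsonLoop (znRep 2) x 0 1 1 1 U * zdWilsonLoop (znRep 2) x' 0 1 1 1 U) -
      zdExpect (znRep 2) β (gaugeBox M) (zdWilsonLoop (znRep 2) x 0 1 1 1) *
        zdExpect (znRep 2) β (gaugeBox M) (zdWilsonLoop (znRep 2) x' 0 1 1 1)) atTop
      (𝓝 (z2PlaquettePairCov β x N)) := by
    have : z2PlaquettePairCov β x N = znWilsonPairLimit 2 β x 0 1 1 1 x' 0 1 1 1 -
        znWilsonLoopLimit 2 β x 0 1 1 1 * znWilsonLoopLimit 2 β x' 0 1 1 1 := rfl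
    rw [this]
    exact hP.sub (hA.mul hB)
  -- Ising side along the cubes
  have hI : Tendsto (fun M : ℕ => Real.sinh (2 * dualBeta β) ^ 2 *
      (isingCorr (zdGraph 3) (box 3 M) (dualBeta β) 0 .plus (verts {((x, 0, 1) : Plaq 3)} ∆ verts {((x', 0, 1) : Plaq 3)}) -
        isingCorr (zdGraph 3) (box 3 M) (dualBeta β) 0 .plus (verts {((x, 0, 1) : Plaq 3)}) *
          isingCorr (zdGraph 3) (box 3 M) (dualBeta β) 0 .plus (verts {((x', 0, 1) : Plaq 3)}))) atTop
      (𝓝 (Real.sinh (2 * dualBeta β) ^ 2 *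
        (plusCorr 3 (dualBeta β) 0 (verts {((x, 0, 1) : Plaq 3)} ∆ verts {((x', 0, 1) : Plaq 3)}) -
          plusCorr 3 (dualBeta β) 0 (verts {((x, 0, 1) : Plaq 3)}) * plusCorr 3 (dualBeta β) 0 (verts {((x', 0, 1) : Plaq 3)})))) :=
    ((hasBoxLimit_isingCorr_plus_holds hβs le_rfl _).sub
      ((hasBoxLimit_isingCorr_plus_holds hβs le_rfl _).mul
        (hasBoxLimit_isingCorr_plus_holds hβs le_rfl _))).const_mul _
  -- the two sequences agree eventually
  obtain ⟨M₀, hM₀⟩ := exists_forall_subset_box 3 ({x, x'} : Finset (Probability.LatticeModels.Site 3))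
  refine tendsto_nhds_unique (hG.congr' ?_) hI
  filter_upwards [eventually_ge_atTop M₀] with M hM
  have hx : x ∈ box 3 M := hM₀ M hM (Finset.mem_insert_self _ _)
  have hx'' : x' ∈ box 3 M := hM₀ M hM (Finset.mem_insert_of_mem (Finset.mem_singleton_self _))
  simp only [zdWilsonLoop_one_one_eq]
  exact zdCov_plaqSpin_eq hβ hx hx'' hne

end InfiniteVolume

/-! ### §5 The deconfined phase `β > β_c`: plus = free at the dual temperature, the pair-truncation
tree bound, sharpness -/

section Deconfined

/-- In the deconfined phase the dual plus and free states agree on spin products: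
`β > β_c ⟹ β* < β_c^{Ising}(ℤ³) ⟹ m*(β*) = 0 ⟹ ⟨σ_A⟩⁺_{β*} = ⟨σ_A⟩^∅_{β*}`.
[cite: LebowitzMartinlof1972, Theorem; Aizenman2025 §9.3 (uniqueness of the dual state at β* < β_c)] -/
theorem plusCorr_dualBeta_eq_freeCorr {β : ℝ} (h : z2GaugeCriticalBetaThree < β)
    (A : Finset (Probability.LatticeModels.Site 3)) :
    plusCorr 3 (dualBeta β) 0 A = freeCorr 3 (dualBeta β) 0 A := by
  have hβ : 0 < β := z2GaugeCriticalBetaThree_pos.trans h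
  have hβs : 0 ≤ dualBeta β := (dualBeta_pos hβ).le
  have hm := spontaneousMagnetization_eq_zero_of_lt_criticalBeta_holds (d := 3) hβs (dualBeta_lt_criticalBeta h)
  exact (freeCorr_eq_plusCorr_of_spontaneousMagnetization_eq_zero hβs hm A).symm

/-- **Duality of truncated correlations in the deconfined phase, free dual state**: for `β > β_c`,
`Cov_β(W_{σ(x)}, W_{σ(x)+Ne₃}) = sinh²(2β*)·(⟨εε'⟩^∅_{β*} - ⟨ε⟩^∅_{β*}⟨ε'⟩^∅_{β*})`.
[cite: Aizenman2025, §9.2 Thm 9.2 (2) and §9.3; DuncanSchweinhart2026 Prop. 24 (p. 19)] -/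
theorem z2PlaquettePairCov_eq_sinh_sq_mul_freeCov {β : ℝ} (h : z2GaugeCriticalBetaThree < β)
    (x : Probability.LatticeModels.Site 3) {N : ℕ} (hN : 1 ≤ N) :
    z2PlaquettePairCov β x N =
      Real.sinh (2 * dualBeta β) ^ 2 *
        (freeCorr 3 (dualBeta β) 0 (verts {((x, 0, 1) : Plaq 3)} ∆ verts {((x + Pi.single 2 (N : ℤ), 0, 1) : Plaq 3)}) -
          freeCorr 3 (dualBeta β) 0 (verts {((x, 0, 1) : Plaq 3)}) *
            freeCorr 3 (dualBeta β) 0 (verts {((x + Pi.single 2 (N : ℤ), 0, 1) : Plaq 3)})) := by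
  rw [z2PlaquettePairCov_eq_sinh_sq_mul_plusCov (z2GaugeCriticalBetaThree_pos.trans h) x hN,
    plusCorr_dualBeta_eq_freeCorr h, plusCorr_dualBeta_eq_freeCorr h, plusCorr_dualBeta_eq_freeCorr h]

/-- The sup norm of a lattice vector dominates its `e₃`-coordinate. [folklore] -/
private theorem abs_apply_two_le_norm (v : Probability.LatticeModels.Site 3) : |((v 2 : ℤ) : ℝ)| ≤ ‖v‖ := by
  have h := norm_le_pi_norm v 2
  rwa [Int.norm_eq_abs] at h

/-- A singleton symmetric difference of two points on the `e₃`-axis through `x` is `∅` or a pair,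
and its free two-point function is bounded by the sharpness rate at their distance:
`⟨σ_{{a}∆{b}}⟩^∅_β ≤ e^{-κD}` whenever `D ≤ |k'-k|`, `a = x + ke₃`, `b = x + k'e₃`.
[cite: AizenmanBarskyFernandezJSP1987, Thm. 1] -/
theorem freeCorr_singleton_symmDiff_le {β κ : ℝ} (hβ : 0 ≤ β) (hκ : 0 < κ)
    (hdec : ∀ v : Probability.LatticeModels.Site 3, twoPointFree 3 β v ≤ Real.exp (-κ * ‖v‖))
    (x : Probability.LatticeModels.Site 3) {k k' : ℤ} {D : ℝ} (hD : D ≤ |(((k' - k : ℤ)) : ℝ)|) :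
    freeCorr 3 β 0 (({x + Pi.single 2 k} : Finset (Probability.LatticeModels.Site 3)) ∆ {x + Pi.single 2 k'}) ≤
      Real.exp (-κ * D) := by
  by_cases hk : k = k'
  · subst hk
    rw [symmDiff_self, Finset.bot_eq_empty, freeCorr_empty hβ le_rfl]
    have : D ≤ 0 := by simpa using hD
    rw [← Real.exp_zero]; exact Real.exp_le_exp.2 (by nlinarith)
  · set a := x + Pi.single (2 : Fin 3) k with ha
    set v : Probability.LatticeModels.Site 3 := Pi.single 2 (k' - k) with hv
    have hab : x + Pi.single (2 : Fin 3) k' = a + v := by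
      rw [ha, hv]
      ext t
      simp only [Pi.add_apply, Pi.single_apply]
      split_ifs <;> ring
    have hv0 : v ≠ 0 := by
      intro h0
      have := congrFun h0 2
      simp [hv] at this
      omega
    have hne : a ≠ a + v := by
      intro h; exact hv0 (left_eq_add.1 h)
    have hpair : (({a} : Finset (Probability.LatticeModels.Site 3)) ∆ {a + v}) = {a, a + v} := by
      ext z
      simp only [Finset.mem_symmDiff, Finset.mem_singleton, Finset.mem_insert]
      constructor
      · rintro (⟨h1, -⟩ | ⟨h1, -⟩)
        · exact Or.inl h1
        · exact Or.inr h1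
      · rintro (rfl | rfl)
        · exact Or.inl ⟨rfl, hne⟩
        · exact Or.inr ⟨rfl, fun h => hne h.symm⟩
    rw [hab, hpair, freeCorr_pair_shift hβ a v, ← twoPointFree_eq_freeCorr _ hv0]
    refine (hdec v).trans (Real.exp_le_exp.2 ?_)
    have hvn : |(((k' - k : ℤ)) : ℝ)| ≤ ‖v‖ := by
      have := abs_apply_two_le_norm v
      simpa [hv] using this
    nlinarith

/-- The members of a dual pair on the axis: `a ∈ {x+(c-1)e₃, x+ce₃}` is `x + ke₃` with
`k ∈ {c-1, c}`, and removing it leaves the other point `x + (2c-1-k)e₃`. [folklore] -/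
private theorem mem_axisPair {x : Probability.LatticeModels.Site 3} {c : ℤ} {a : Probability.LatticeModels.Site 3}
    (ha : a ∈ ({x + Pi.single 2 (c - 1), x + Pi.single 2 c} : Finset (Probability.LatticeModels.Site 3))) :
    ∃ k : ℤ, (k = c - 1 ∨ k = c) ∧ a = x + Pi.single 2 k ∧
      ({x + Pi.single 2 (c - 1), x + Pi.single 2 c} : Finset (Probability.LatticeModels.Site 3)) \ {a} =
        {x + Pi.single 2 (2 * c - 1 - k)} := by
  have hne : x + Pi.single (2 : Fin 3) (c - 1) ≠ x + Pi.single 2 c := fun h =>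
    by have := add_single_injective x h; omega
  rw [Finset.mem_insert, Finset.mem_singleton] at ha
  rcases ha with rfl | rfl
  · refine ⟨c - 1, Or.inl rfl, rfl, ?_⟩
    rw [show 2 * c - 1 - (c - 1) = c by ring]
    ext z
    simp only [Finset.mem_sdiff, Finset.mem_insert, Finset.mem_singleton]
    constructor
    · rintro ⟨h1 | h1, h2⟩
      · exact absurd h1 h2
      · exact h1
    · rintro rfl; exact ⟨Or.inr rfl, fun h => hne h.symm⟩
  · refine ⟨c, Or.inr rfl, rfl, ?_⟩
    rw [show 2 * c - 1 - c = c - 1 by ring]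
    ext z
    simp only [Finset.mem_sdiff, Finset.mem_insert, Finset.mem_singleton]
    constructor
    · rintro ⟨h1 | h1, h2⟩
      · exact h1
      · exact absurd h1 h2
    · rintro rfl; exact ⟨Or.inl rfl, hne⟩

/-- **The energy–energy covariance of the free Ising state on `ℤ³` decays with twice the two-point
rate**: if `⟨σ_0σ_v⟩^∅_β ≤ e^{-κ‖v‖}` for all `v` then for the dual bonds `ε = {x-e₃,x}`,
`ε' = {x+(N-1)e₃, x+Ne₃}`,
`⟨σ_ε σ_{ε'}⟩^∅ - ⟨σ_ε⟩^∅⟨σ_{ε'}⟩^∅ ≤ 8 e^{-2κ(N-1)}` — by the pair-truncation tree bound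
(Glimm–Jaffe Cor. 4.3.3, the tree's `freeCorr_two_mul_cov_le_sum_odd`): the right-hand side is a sum
over the (at most `16`, in fact `4`) odd–odd splittings, each a product of two two-point functions
between a point of `ε` and a point of `ε'`, at sup-distance `≥ N - 1`.
[cite: GlimmJaffe1987, Cor. 4.3.3; Lebowitz1974 Theorem] -/
theorem freeCov_dualBonds_le {β κ : ℝ} (hβ : 0 ≤ β) (hκ : 0 < κ)
    (hdec : ∀ v : Probability.LatticeModels.Site 3, twoPointFree 3 β v ≤ Real.exp (-κ * ‖v‖))
    (x : Probability.LatticeModels.Site 3) (N : ℕ) :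
    freeCorr 3 β 0 (verts {((x, 0, 1) : Plaq 3)} ∆ verts {((x + Pi.single 2 (N : ℤ), 0, 1) : Plaq 3)}) -
        freeCorr 3 β 0 (verts {((x, 0, 1) : Plaq 3)}) * freeCorr 3 β 0 (verts {((x + Pi.single 2 (N : ℤ), 0, 1) : Plaq 3)}) ≤
      8 * Real.exp (-κ * ((N : ℝ) - 1)) ^ 2 := by
  classical
  set A := verts {((x, 0, 1) : Plaq 3)} with hA
  set B := verts {((x + Pi.single 2 (N : ℤ), 0, 1) : Plaq 3)} with hB
  have hAeq : A = {x + Pi.single 2 ((0 : ℤ) - 1), x + Pi.single 2 (0 : ℤ)} := by rw [hA, verts_unitPlaq_eq]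
  have hBeq : B = {x + Pi.single 2 ((N : ℤ) - 1), x + Pi.single 2 (N : ℤ)} := by rw [hB, verts_unitPlaq_add_single]
  have hA2 : A.card = 2 := by rw [hA, card_verts_unitPlaq]
  have hB2 : B.card = 2 := by rw [hB, card_verts_unitPlaq]
  have hAc : Even A.card := by rw [hA2]; exact even_two
  have hBc : Even B.card := by rw [hB2]; exact even_two
  have hGJ := freeCorr_two_mul_cov_le_sum_odd (d := 3) hβ hAc hBc
  -- every term of the tree bound is at most `e^{-κ(N-1)}²`
  set E := Real.exp (-κ * ((N : ℝ) - 1)) with hE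
  have hE0 : 0 ≤ E := (Real.exp_pos _).le
  have hterm : ∀ p ∈ (A.powerset ×ˢ B.powerset).filter (fun p => Odd p.1.card ∧ Odd p.2.card),
      freeCorr 3 β 0 (p.1 ∆ p.2) * freeCorr 3 β 0 ((A \ p.1) ∆ (B \ p.2)) ≤ E ^ 2 := by
    intro p hp
    rw [Finset.mem_filter, Finset.mem_product, Finset.mem_powerset, Finset.mem_powerset] at hp
    obtain ⟨⟨h1, h2⟩, ho1, ho2⟩ := hp
    -- `p.1 = {a}`, `p.2 = {b}`
    have hc1 : p.1.card = 1 := by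
      have := (Finset.card_le_card h1).trans_eq hA2
      rcases ho1 with ⟨m, hm⟩; omega
    have hc2 : p.2.card = 1 := by
      have := (Finset.card_le_card h2).trans_eq hB2
      rcases ho2 with ⟨m, hm⟩; omega
    obtain ⟨a, hpa⟩ := Finset.card_eq_one.1 hc1
    obtain ⟨b, hpb⟩ := Finset.card_eq_one.1 hc2
    have haA : a ∈ A := h1 (by rw [hpa]; exact Finset.mem_singleton_self a)
    have hbB : b ∈ B := h2 (by rw [hpb]; exact Finset.mem_singleton_self b)
    rw [hAeq] at haA
    rw [hBeq] at hbB
    obtain ⟨k, hk, rfl, hsdA⟩ := mem_axisPair haA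
    obtain ⟨k', hk', rfl, hsdB⟩ := mem_axisPair hbB
    rw [hpa, hpb, hAeq, hBeq, hsdA, hsdB]
    have hkk : ((N : ℝ) - 1) ≤ |(((k' - k : ℤ)) : ℝ)| := by
      refine le_trans ?_ (le_abs_self _)
      push_cast
      rcases hk with rfl | rfl <;> rcases hk' with rfl | rfl <;> push_cast <;> linarith
    have hkk' : ((N : ℝ) - 1) ≤ |(((2 * (N : ℤ) - 1 - k' - (2 * 0 - 1 - k) : ℤ)) : ℝ)| := by
      refine le_trans ?_ (le_abs_self _)
      push_cast
      rcases hk with rfl | rfl <;> rcases hk' with rfl | rfl <;> push_cast <;> linarith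
    rw [sq]
    exact mul_le_mul (freeCorr_singleton_symmDiff_le hβ hκ hdec x hkk)
      (freeCorr_singleton_symmDiff_le hβ hκ hdec x hkk') (freeCorr_nonneg hβ le_rfl _) hE0
  have hsum := Finset.sum_le_sum hterm
  rw [Finset.sum_const, nsmul_eq_mul] at hsum
  have hcard : (((A.powerset ×ˢ B.powerset).filter (fun p => Odd p.1.card ∧ Odd p.2.card)).card : ℝ) ≤ 16 := by
    have h := (Finset.card_filter_le (A.powerset ×ˢ B.powerset) (fun p => Odd p.1.card ∧ Odd p.2.card))
    rw [Finset.card_product, Finset.card_powerset, Finset.card_powerset, hA2, hB2] at h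
    exact_mod_cast h
  have hE2 : 0 ≤ E ^ 2 := sq_nonneg _
  nlinarith

/-- **The plaquette–plaquette mass gap of `ℤ₂` lattice gauge theory on `ℤ³` in the DECONFINED
phase, as a THEOREM** (the `β > β_c` half of the upper bound of Duncan–Schweinhart 2026 Thm 8 ∕
Prop. 24 for `q = 2`, `d = 3`, unit plaquettes — proved here by duality (Aizenman 2025 Thm 9.2),
Lebowitz–Martin-Löf, the Lebowitz ∕ Glimm–Jaffe pair-truncation tree bound and ABF ∕ DCT sharpness,
WITHOUT the named fact `DuncanSchweinhart2026_z2GaugeThree_plaquetteCovDecay`): for every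
`β > β_c = artanh e^{-2β_c^{Ising}(ℤ³)}` there are `m > 0` and `c` with
`0 ≤ Cov_β(W_{σ(x)}, W_{σ(x)+Ne₃}) ≤ c e^{-mN}` for all `x` and all `N`; explicitly `m = 2κ(β*)`,
`c = 8 sinh²(2β*) e^{2κ}`, `κ` the sharpness rate of the dual two-point function at `β* < β_c^{Ising}`.
The strong-coupling half is `z2PlaquettePairCov_le_exp_neg_of_strongCoupling`.
[cite: DuncanSchweinhart2026, Thm 8 (p. 4) and Prop. 24 (pp. 19–20, the dual-subcritical case); Aizenman2025 Thm 9.2; GlimmJaffe1987 Cor. 4.3.3; AizenmanBarskyFernandezJSP1987 Thm. 1] -/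
theorem z2PlaquettePairCov_le_exp_neg_of_gt_critical {β : ℝ} (h : z2GaugeCriticalBetaThree < β) :
    ∃ m c : ℝ, 0 < m ∧ ∀ (x : Probability.LatticeModels.Site 3) (N : ℕ),
      0 ≤ z2PlaquettePairCov β x N ∧ z2PlaquettePairCov β x N ≤ c * Real.exp (-(m * N)) := by
  have hβ : 0 < β := z2GaugeCriticalBetaThree_pos.trans h
  have hβs0 : 0 < dualBeta β := dualBeta_pos hβ
  have hβsc : dualBeta β < criticalBeta 3 := dualBeta_lt_criticalBeta h
  obtain ⟨κ, hκ, hdec⟩ := twoPoint_exponentialDecay_of_lt_criticalBeta_holds (d := 3) (by norm_num)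
    hβs0.le hβsc
  -- the constant: `8 sinh²(2β*) e^{2κ}` for `N ≥ 1`, and `≥ 1` to cover the variance at `N = 0`
  refine ⟨2 * κ, max 1 (8 * Real.sinh (2 * dualBeta β) ^ 2 * Real.exp (2 * κ)), by positivity,
    fun x N => ?_⟩
  refine ⟨(z2PlaquettePairCov_mem_Icc hβ.le x N).1, ?_⟩
  rcases Nat.eq_zero_or_pos N with rfl | hN
  · -- `N = 0` (the two plaquettes coincide): the trivial bound `Cov ≤ 1`
    have h1 : z2PlaquettePairCov β x 0 ≤ 1 := (z2PlaquettePairCov_mem_Icc hβ.le x 0).2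
    have h2 : (1 : ℝ) ≤ max 1 (8 * Real.sinh (2 * dualBeta β) ^ 2 * Real.exp (2 * κ)) := le_max_left _ _
    simpa using h1.trans h2
  · have hcov := freeCov_dualBonds_le hβs0.le hκ hdec x N
    rw [z2PlaquettePairCov_eq_sinh_sq_mul_freeCov h x hN]
    have hs : 0 ≤ Real.sinh (2 * dualBeta β) ^ 2 := sq_nonneg _
    have hexp : Real.exp (-κ * ((N : ℝ) - 1)) ^ 2 = Real.exp (2 * κ) * Real.exp (-(2 * κ * N)) := by
      rw [sq, ← Real.exp_add, ← Real.exp_add]; congr 1; ring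
    have h1 := mul_le_mul_of_nonneg_left hcov hs
    rw [hexp] at h1
    have h2 : 8 * Real.sinh (2 * dualBeta β) ^ 2 * Real.exp (2 * κ) ≤
        max 1 (8 * Real.sinh (2 * dualBeta β) ^ 2 * Real.exp (2 * κ)) := le_max_right _ _
    have h3 : 0 < Real.exp (-(2 * κ * N)) := Real.exp_pos _
    calc _ ≤ Real.sinh (2 * dualBeta β) ^ 2 * (8 * (Real.exp (2 * κ) * Real.exp (-(2 * κ * N)))) := h1
      _ = (8 * Real.sinh (2 * dualBeta β) ^ 2 * Real.exp (2 * κ)) * Real.exp (-(2 * κ * N)) := by ring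
      _ ≤ max 1 (8 * Real.sinh (2 * dualBeta β) ^ 2 * Real.exp (2 * κ)) * Real.exp (-(2 * κ * N)) :=
          mul_le_mul_of_nonneg_right h2 h3.le

end Deconfined

end Z2Duality

/-! ### §6 In the shape of the named fact: `Cov ≤ e^{-c₀N}` for `N ≥ 1`, and what remains of it -/

section FactShape

open Z2Duality

/-- `tanh β ≥ 0` for `β ≥ 0`. [folklore] -/
private theorem tanh_nonneg_of_nonneg {β : ℝ} (hβ : 0 ≤ β) : 0 ≤ Real.tanh β := by
  rw [Real.tanh_eq_sinh_div_cosh]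
  exact div_nonneg (Real.sinh_nonneg_iff.2 hβ) (Real.cosh_pos _).le

/-- **The plaquette–plaquette covariance is bounded away from `1`**:
`Cov_β(W_σ, W_{σ'}) ≤ 1 - tanh²β` (`⟨W_σW_{σ'}⟩ ≤ 1` and `⟨W_σ⟩ = ⟨W_{σ'}⟩ ≥ tanh β`, the
one-plaquette lower bound of Forsström–Viklund Prop. 6.6 in the limit,
`tanh_pow_le_znWilsonLoopLimit_two`). [cite: ForsstromViklund2025currents, Prop. 6.6; DuncanSchweinhart2026 Prop. 24 (Cov ≤ e^{-c₀N} < 1)] -/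
theorem z2PlaquettePairCov_le_one_sub_tanh_sq {β : ℝ} (hβ : 0 ≤ β) (x : Probability.LatticeModels.Site 3)
    (N : ℕ) : z2PlaquettePairCov β x N ≤ 1 - Real.tanh β ^ 2 := by
  have h01 : (0 : Fin 3) ≠ 1 := by decide
  have hP := znWilsonPairLimit_le_one (n := 2) hβ x (x + Pi.single 2 (N : ℤ)) h01 h01 1 1 1 1
  have hW := tanh_pow_le_znWilsonLoopLimit_two hβ x h01 1 1
  have hW' := tanh_pow_le_znWilsonLoopLimit_two hβ (x + Pi.single 2 (N : ℤ)) h01 1 1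
  rw [mul_one, pow_one] at hW hW'
  have ht : 0 ≤ Real.tanh β := tanh_nonneg_of_nonneg hβ
  have hprod : Real.tanh β ^ 2 ≤ znWilsonLoopLimit 2 β x 0 1 1 1 *
      znWilsonLoopLimit 2 β (x + Pi.single 2 (N : ℤ)) 0 1 1 1 := by
    rw [sq]; exact mul_le_mul hW hW' ht (znWilsonLoopLimit_nonneg hβ x h01 1 1)
  unfold z2PlaquettePairCov znWilsonPairCov
  linarith

/-- Calculus: `e^t ≥ 1 + t`, so `c ≤ e^{(m/2) N₁}` once `(m/2) N₁ ≥ c`. [folklore] -/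
private theorem exists_nat_exp_ge {m : ℝ} (hm : 0 < m) (c : ℝ) :
    ∃ N₁ : ℕ, 1 ≤ N₁ ∧ c ≤ Real.exp (m / 2 * N₁) := by
  obtain ⟨n, hn⟩ := exists_nat_ge (2 * c / m)
  refine ⟨n + 1, by omega, ?_⟩
  have h1 : c ≤ m / 2 * ((n + 1 : ℕ) : ℝ) := by
    push_cast
    have : 2 * c / m * (m / 2) = c := by field_simp
    nlinarith
  exact h1.trans ((by linarith : m / 2 * ((n + 1 : ℕ) : ℝ) ≤ 1 + m / 2 * ((n + 1 : ℕ) : ℝ)).trans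
    (Real.add_one_le_exp _ |>.trans_eq' (by ring)))

/-- **The deconfined-phase upper bound in the shape of Duncan–Schweinhart's Thm 8**: for every
`β > β_c` there is `c₀ > 0` with `Cov_β(W_{σ(x)}, W_{σ(x)+Ne₃}) ≤ e^{-c₀N}` for all `x` and all `N ≥ 1`
(the prefactor of `z2PlaquettePairCov_le_exp_neg_of_gt_critical` is absorbed using
`Cov ≤ 1 - tanh²β < 1` for the finitely many small `N`). [cite: DuncanSchweinhart2026, Thm 8 (p. 4) and Prop. 24 (p. 19)] -/
theorem z2PlaquettePairCov_le_exp_neg_of_gt_critical' {β : ℝ} (h : z2GaugeCriticalBetaThree < β) :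
    ∃ c₀ : ℝ, 0 < c₀ ∧ ∀ (x : Probability.LatticeModels.Site 3) (N : ℕ), 1 ≤ N →
      z2PlaquettePairCov β x N ≤ Real.exp (-(c₀ * N)) := by
  have hβ : 0 < β := z2GaugeCriticalBetaThree_pos.trans h
  obtain ⟨m, c, hm, hmc⟩ := z2PlaquettePairCov_le_exp_neg_of_gt_critical h
  obtain ⟨N₁, hN₁, hcN₁⟩ := exists_nat_exp_ge hm c
  -- `q = 1 - tanh²β ∈ (0, 1)`
  set q : ℝ := 1 - Real.tanh β ^ 2 with hq
  have ht0 : 0 < Real.tanh β := by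
    rw [Real.tanh_eq_sinh_div_cosh]; exact div_pos (Real.sinh_pos_iff.2 hβ) (Real.cosh_pos β)
  have ht1 : Real.tanh β < 1 := Real.tanh_lt_one β
  have hq0 : 0 < q := by rw [hq]; nlinarith
  have hq1 : q < 1 := by rw [hq]; nlinarith
  have hlq : 0 < -Real.log q := by rw [neg_pos]; exact Real.log_neg hq0 hq1
  have hN₁' : (0 : ℝ) < N₁ := by exact_mod_cast hN₁
  refine ⟨min (m / 2) (-Real.log q / N₁), lt_min (by linarith) (div_pos hlq hN₁'), fun x N hN => ?_⟩
  have hc0m : min (m / 2) (-Real.log q / N₁) ≤ m / 2 := min_le_left _ _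
  have hc0q : min (m / 2) (-Real.log q / N₁) ≤ -Real.log q / N₁ := min_le_right _ _
  have hN0 : (0 : ℝ) ≤ N := by exact_mod_cast (Nat.zero_le N)
  rcases le_or_gt N₁ N with hle | hlt
  · -- large `N`: `c e^{-mN} ≤ e^{(m/2)N} e^{-mN} = e^{-(m/2)N} ≤ e^{-c₀N}`
    have hle' : (N₁ : ℝ) ≤ N := by exact_mod_cast hle
    refine ((hmc x N).2).trans ?_
    have hc' : c ≤ Real.exp (m / 2 * N) :=
      hcN₁.trans (Real.exp_le_exp.2 (mul_le_mul_of_nonneg_left hle' (by linarith)))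
    calc c * Real.exp (-(m * N)) ≤ Real.exp (m / 2 * N) * Real.exp (-(m * N)) :=
          mul_le_mul_of_nonneg_right hc' (Real.exp_pos _).le
      _ = Real.exp (-(m / 2 * N)) := by rw [← Real.exp_add]; congr 1; ring
      _ ≤ Real.exp (-(min (m / 2) (-Real.log q / N₁) * N)) :=
          Real.exp_le_exp.2 (by nlinarith)
  · -- small `N`: `Cov ≤ q = e^{log q} ≤ e^{-c₀ N}` since `c₀ N ≤ c₀ N₁ ≤ -log q`
    have hlt' : (N : ℝ) ≤ N₁ := by exact_mod_cast hlt.le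
    refine (z2PlaquettePairCov_le_one_sub_tanh_sq hβ.le x N).trans ?_
    have h1 : min (m / 2) (-Real.log q / N₁) * N ≤ -Real.log q / N₁ * N₁ :=
      (mul_le_mul_of_nonneg_right hc0q hN0).trans
        (mul_le_mul_of_nonneg_left hlt' (div_pos hlq hN₁').le)
    rw [div_mul_cancel₀ _ hN₁'.ne'] at h1
    rw [← hq]
    calc q = Real.exp (Real.log q) := (Real.exp_log hq0).symm
      _ ≤ Real.exp (-(min (m / 2) (-Real.log q / N₁) * N)) := Real.exp_le_exp.2 (by linarith)

/-- **What remains of the named fact.** `DuncanSchweinhart2026_z2GaugeThree_plaquetteCovDecay`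
follows from (i) the LOWER bounds `e^{-c₁N} ≤ Cov_β` for all `β > 0`, `β ≠ β_c` (finite energy of
the plaquette random-cluster representation — not in the tree) and (ii) the UPPER bounds in the
CONFINED phase `0 < β < β_c` (dual supercritical Ising: [Bod05], [DCGR20] — not in the tree beyond
strong coupling, `z2PlaquettePairCov_le_exp_neg_of_strongCoupling`); the upper bounds in the
deconfined phase `β > β_c` are supplied by this file. [cite: DuncanSchweinhart2026, Thm 8 (p. 4) and Prop. 24 (pp. 19–20)] -/
theorem DuncanSchweinhart2026_z2GaugeThree_plaquetteCovDecay_of_lower_of_confinedUpper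
    (hlower : ∀ β : ℝ, 0 < β → β ≠ z2GaugeCriticalBetaThree →
      ∃ c₁ : ℝ, 0 < c₁ ∧ ∀ N : ℕ, 1 ≤ N → Real.exp (-(c₁ * N)) ≤ z2PlaquettePairCov β 0 N)
    (hupper : ∀ β : ℝ, 0 < β → β < z2GaugeCriticalBetaThree →
      ∃ c₀ : ℝ, 0 < c₀ ∧ ∀ N : ℕ, 1 ≤ N → z2PlaquettePairCov β 0 N ≤ Real.exp (-(c₀ * N))) :
    DuncanSchweinhart2026_z2GaugeThree_plaquetteCovDecay := by
  intro β hβ hne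
  obtain ⟨c₁, hc₁, hlo⟩ := hlower β hβ hne
  -- the upper bound on either side of `β_c`
  have hup : ∃ c₀ : ℝ, 0 < c₀ ∧ ∀ N : ℕ, 1 ≤ N → z2PlaquettePairCov β 0 N ≤ Real.exp (-(c₀ * N)) := by
    rcases lt_or_gt_of_ne hne with hlt | hgt
    · exact hupper β hβ hlt
    · obtain ⟨c₀, hc₀, hN⟩ := z2PlaquettePairCov_le_exp_neg_of_gt_critical' hgt
      exact ⟨c₀, hc₀, fun N hN1 => hN 0 N hN1⟩
  obtain ⟨c₀, hc₀, hhi⟩ := hup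
  refine ⟨min c₀ (c₁ / 2), c₁, lt_min hc₀ (by linarith), (min_le_right _ _).trans_lt (by linarith),
    fun N hN1 => ⟨hlo N hN1, (hhi N hN1).trans (Real.exp_le_exp.2 ?_)⟩⟩
  have hN0 : (0 : ℝ) ≤ N := by exact_mod_cast (Nat.zero_le N)
  nlinarith [min_le_left c₀ (c₁ / 2)]

end FactShape

end Literature.MathematicalPhysics.QuantumFieldTheory
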